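import Literature.Analysis.SpecialFunctions.RealGaussianComplexQuadratic
import HarnessLib

/-!
# Real Gaussian integrals with a complex symmetric precision and a complex linear term:
# `∫ e^{-xᵀAx/2 + Jᵀx} dx = e^{JᵀA⁻¹J/2} · ∫ e^{-xᵀAx/2} dx`

Topic `Analysis/SpecialFunctions`, sibling of `RealGaussianComplexQuadratic.lean` (the branch-free
normalisation `(∫ e^{-xᵀBx/2 + xᵀMx})²·det(B − 2M) = (2π)ⁿ`). Here: the REAL `n`-dimensional Lebesgue
integral of `e^{-xᵀAx/2 + Jᵀx}` for a COMPLEX SYMMETRIC precision `A` with positive definite real part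
`Re A ≻ 0` and an arbitrary COMPLEX vector `J ∈ ℂⁿ` — "completion of the square"

  `∫_{ℝⁿ} e^{-½xᵀAx + Jᵀx} dx = e^{½JᵀA⁻¹J} ∫_{ℝⁿ} e^{-½xᵀAx} dx`,

equivalently the moment generating function of the (complex) Gaussian "measure" `e^{-½xᵀAx}dx / ∫e^{-½xᵀAx}`
is `J ↦ e^{½JᵀA⁻¹J}` on all of `ℂⁿ` (Hörmander *ALPDO I* Thm 7.6.1 is the `J`-dependent Fourier form;
Zinn-Justin §1.1; Glimm–Jaffe §9.1 for the real case).

At a REAL centre (`A`, `J` real) this is the translation `x ↦ x − A⁻¹J` of Lebesgue measure.  At a complex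
centre `A⁻¹J ∉ ℝⁿ` translation is not available; the textbook route is analytic continuation in `J` (and in
`A`).  We avoid continuation altogether: with `A = P + iQ` (`P ≻ 0`, `Q` real symmetric) a real congruence
`TᵀPT = 1`, `TᵀQT = diag(d)` (`RealGaussianComplexQuadratic.exists_transpose_mul_mul_eq_one_and_eq_diagonal`)
and the substitution `x = Ty` (`integral_comp_mulVec_real`) factorise the integral into one-dimensional
integrals `∫ e^{-b y² + c y} dy = (π/b)^{1/2} e^{c²/(4b)}`, `b = (1 + i d_k)/2`, `c = (TᵀJ)_k ∈ ℂ`, which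
Mathlib has WITH the complex linear term (`GaussianFourier.integral_cexp_neg_sum_mul_add`); and
`Σ_k c_k²/(4b_k) = ½JᵀA⁻¹J` because `A⁻¹ = T·diag(2b)⁻¹·Tᵀ`.  No branch of a square root and no identity
theorem is involved; the normalisation `∫ e^{-½xᵀAx}` is left unevaluated (its square is
`RealGaussianComplexQuadratic.sq_integral_cexp_quadratic_mul_det`).

## Contents
* (private plumbing: `(Ty)ᵀM(Ty) = yᵀ(TᵀMT)y` over a commutative semiring, `A = Re A + i Im A`, `↑(Ty) = ↑T ↑y`);
* **`integral_cexp_neg_half_quadratic_add_linear`** — the displayed formula;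
* `integral_cexp_neg_half_quadratic_ne_zero` — `∫ e^{-½xᵀAx} ≠ 0` in this phrasing (from the sibling file);
* `div_integral_cexp_neg_half_quadratic_add_linear` — the normalised ("generating function") form;
* `integral_cexp_neg_half_quadratic_sub_linear` — the same with `e^{-Jᵀx}` (the form met in cluster
  expansions, e.g. Bałaban CMP 116 (2.14): `∫dμ_{A⁻¹}(B) e^{-⟨B,ΓX⟩} = e^{½⟨ΓX,A⁻¹ΓX⟩}`).
-/

noncomputable section

namespace Literature.Analysis.SpecialFunctions

open _root_.MeasureTheory _root_.Matrix _root_.Complex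
open scoped BigOperators ComplexOrder MatrixOrder _root_.Real

variable {ι : Type*} [Fintype ι] [DecidableEq ι]

/-! ### Algebra -/

omit [DecidableEq ι] in
/-- Transport of a quadratic form under `x = Ty` over a commutative semiring: `(Ty)ᵀM(Ty) = yᵀ(TᵀMT)y`
(`RealGaussianComplexQuadratic.dotProduct_mulVec_mulVec_eq` is the real case). [folklore] -/
private theorem dotProduct_mulVec_mulVec_eq_comm {R : Type*} [CommSemiring R] (T M : Matrix ι ι R) (y : ι → R) :
    (T *ᵥ y) ⬝ᵥ (M *ᵥ (T *ᵥ y)) = y ⬝ᵥ ((Tᵀ * M * T) *ᵥ y) := by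
  rw [Matrix.mulVec_mulVec, ← Matrix.vecMul_transpose, ← Matrix.dotProduct_mulVec,
    Matrix.mulVec_mulVec, Matrix.mul_assoc]

omit [Fintype ι] [DecidableEq ι] in
/-- A complex matrix is its real part plus `i` times its imaginary part (entrywise `z = Re z + i Im z`).
[folklore] -/
private theorem matrix_eq_map_re_add_I_smul_map_im (A : Matrix ι ι ℂ) :
    A = (A.map Complex.re).map Complex.ofReal + I • (A.map Complex.im).map Complex.ofReal := by
  ext i j
  simp only [Matrix.add_apply, Matrix.smul_apply, Matrix.map_apply, smul_eq_mul]
  apply Complex.ext <;> simp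

omit [Fintype ι] [DecidableEq ι] in
/-- For a real matrix `T` and a real vector `y`: `↑(Ty) = (↑T)(↑y)` in `ℂⁿ`. [folklore] -/
private theorem ofReal_mulVec_eq [Fintype ι] (T : Matrix ι ι ℝ) (y : ι → ℝ) :
    (fun i => (((T *ᵥ y) i : ℝ) : ℂ)) = T.map Complex.ofReal *ᵥ fun i => (y i : ℂ) := by
  funext i
  simp only [Matrix.mulVec, dotProduct, Matrix.map_apply, Complex.ofReal_sum, Complex.ofReal_mul]

/-! ### The formula -/

/-- **Real Gaussian integral with a complex symmetric precision and a complex linear term.**  For a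
complex symmetric matrix `A` whose real part is positive definite and every `J ∈ ℂⁿ`,
`∫_{ℝⁿ} e^{-½xᵀAx + Jᵀx} dx = e^{½JᵀA⁻¹J} · ∫_{ℝⁿ} e^{-½xᵀAx} dx`
("completing the square" at a complex centre; proved by real congruence diagonalisation of
`(Re A, Im A)` and the one-dimensional formula with a complex linear term — no analytic continuation).
[cite: HormanderALPDO1, Thm 7.6.1] -/
theorem integral_cexp_neg_half_quadratic_add_linear {A : Matrix ι ι ℂ} (hA : A.IsSymm)
    (hAre : (A.map Complex.re).PosDef) (J : ι → ℂ) :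
    ∫ x : ι → ℝ, cexp (-(1 / 2 : ℂ) * ((fun i => (x i : ℂ)) ⬝ᵥ (A *ᵥ fun i => (x i : ℂ))) +
        J ⬝ᵥ fun i => (x i : ℂ)) =
      cexp ((1 / 2 : ℂ) * (J ⬝ᵥ (A⁻¹ *ᵥ J))) *
        ∫ x : ι → ℝ, cexp (-(1 / 2 : ℂ) * ((fun i => (x i : ℂ)) ⬝ᵥ (A *ᵥ fun i => (x i : ℂ)))) := by
  -- real and imaginary parts, congruence diagonalisation
  set P : Matrix ι ι ℝ := A.map Complex.re with hP
  set Q : Matrix ι ι ℝ := A.map Complex.im with hQ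
  have hQs : Q.IsSymm := by
    show (A.map Complex.im)ᵀ = A.map Complex.im
    rw [← Matrix.transpose_map, hA.eq]
  obtain ⟨T, hTdet, hTP, d, hTQ⟩ := exists_transpose_mul_mul_eq_one_and_eq_diagonal hAre hQs
  set Tc : Matrix ι ι ℂ := T.map Complex.ofReal with hTc
  have hofReal : (Complex.ofReal : ℝ → ℂ) = ⇑Complex.ofRealHom := rfl
  have hTP' : Tcᵀ * P.map Complex.ofReal * Tc = 1 := by
    rw [hTc, hofReal, ← Matrix.transpose_map, ← Matrix.map_mul, ← Matrix.map_mul, hTP,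
      Matrix.map_one _ (map_zero _) (map_one _)]
  have hTQ' : Tcᵀ * Q.map Complex.ofReal * Tc = diagonal (fun i => (d i : ℂ)) := by
    rw [hTc, hofReal, ← Matrix.transpose_map, ← Matrix.map_mul, ← Matrix.map_mul, hTQ,
      Matrix.diagonal_map (map_zero _)]
  -- the one-dimensional coefficients `b_k = (1 + i d_k)/2`
  set b : ι → ℂ := fun i => 1 / 2 + I * ((d i / 2 : ℝ) : ℂ) with hb
  have hbre : ∀ i, 0 < (b i).re := fun i => by simp [hb]
  have hbne : ∀ i, b i ≠ 0 := fun i h => by simpa [h] using hbre i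
  have h2b : ∀ i, 2 * b i = 1 + I * (d i : ℂ) := fun i => by
    simp only [hb]; push_cast; ring
  have h2bne : ∀ i, 2 * b i ≠ 0 := fun i => mul_ne_zero two_ne_zero (hbne i)
  set D : Matrix ι ι ℂ := diagonal (fun i => 2 * b i) with hD
  -- `Tᵀ A T = diag(2b)`
  have hconj : Tcᵀ * A * Tc = D := by
    rw [matrix_eq_map_re_add_I_smul_map_im A, ← hP, ← hQ, Matrix.mul_add, Matrix.add_mul, Matrix.mul_smul,
      Matrix.smul_mul, hTP', hTQ', hD]
    ext i j
    by_cases hij : i = j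
    · subst hij
      simp only [Matrix.add_apply, Matrix.one_apply_eq, Matrix.smul_apply, Matrix.diagonal_apply_eq, smul_eq_mul,
        h2b]
    · simp [hij]
  -- the exponent under `x = Ty`
  set c : ι → ℂ := Tcᵀ *ᵥ J with hc
  have hquad : ∀ y : ι → ℝ,
      (fun i => (((T *ᵥ y) i : ℝ) : ℂ)) ⬝ᵥ (A *ᵥ fun i => (((T *ᵥ y) i : ℝ) : ℂ)) = ∑ i, 2 * b i * (y i : ℂ) ^ 2 :=
    fun y => by
    rw [ofReal_mulVec_eq, ← hTc, dotProduct_mulVec_mulVec_eq_comm, hconj, hD]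
    simp only [dotProduct, mulVec_diagonal]
    exact Finset.sum_congr rfl fun i _ => by ring
  have hlin : ∀ y : ι → ℝ, J ⬝ᵥ (fun i => (((T *ᵥ y) i : ℝ) : ℂ)) = ∑ i, c i * (y i : ℂ) := fun y => by
    rw [ofReal_mulVec_eq, ← hTc, Matrix.dotProduct_mulVec, ← Matrix.mulVec_transpose, ← hc]
    rfl
  have hexp : ∀ y : ι → ℝ,
      -(1 / 2 : ℂ) * ((fun i => (((T *ᵥ y) i : ℝ) : ℂ)) ⬝ᵥ (A *ᵥ fun i => (((T *ᵥ y) i : ℝ) : ℂ))) +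
          J ⬝ᵥ (fun i => (((T *ᵥ y) i : ℝ) : ℂ))
        = -∑ i, b i * ((y i : ℝ) : ℂ) ^ 2 + ∑ i, c i * (y i : ℂ) := fun y => by
    rw [hquad, hlin, Finset.mul_sum, ← Finset.sum_neg_distrib]
    congr 1
    exact Finset.sum_congr rfl fun i _ => by ring
  have hexp0 : ∀ y : ι → ℝ,
      -(1 / 2 : ℂ) * ((fun i => (((T *ᵥ y) i : ℝ) : ℂ)) ⬝ᵥ (A *ᵥ fun i => (((T *ᵥ y) i : ℝ) : ℂ)))
        = -∑ i, b i * ((y i : ℝ) : ℂ) ^ 2 + ∑ i, (0 : ℂ) * (y i : ℂ) := fun y => by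
    rw [hquad, Finset.mul_sum, ← Finset.sum_neg_distrib]
    simp only [zero_mul, Finset.sum_const_zero, add_zero]
    exact Finset.sum_congr rfl fun i _ => by ring
  -- the two integrands and their pull-backs
  set g : (ι → ℝ) → ℂ := fun x => cexp (-(1 / 2 : ℂ) * ((fun i => (x i : ℂ)) ⬝ᵥ (A *ᵥ fun i => (x i : ℂ))) +
    J ⬝ᵥ fun i => (x i : ℂ)) with hg
  set g₀ : (ι → ℝ) → ℂ := fun x => cexp (-(1 / 2 : ℂ) * ((fun i => (x i : ℂ)) ⬝ᵥ (A *ᵥ fun i => (x i : ℂ))))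
    with hg₀
  have hpull : ∫ y, g (T *ᵥ y) = ∏ i, ((π : ℂ) / b i) ^ (1 / 2 : ℂ) * cexp (c i ^ 2 / (4 * b i)) := by
    calc ∫ y, g (T *ᵥ y) = ∫ y : ι → ℝ, cexp (-∑ i, b i * ((y i : ℝ) : ℂ) ^ 2 + ∑ i, c i * (y i : ℂ)) := by
          refine integral_congr_ae (ae_of_all _ fun y => ?_)
          simp only [hg, hexp y]
      _ = ∏ i, ((π : ℂ) / b i) ^ (1 / 2 : ℂ) * cexp (c i ^ 2 / (4 * b i)) :=
          GaussianFourier.integral_cexp_neg_sum_mul_add hbre c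
  have hpull0 : ∫ y, g₀ (T *ᵥ y) = ∏ i, ((π : ℂ) / b i) ^ (1 / 2 : ℂ) := by
    calc ∫ y, g₀ (T *ᵥ y) = ∫ y : ι → ℝ, cexp (-∑ i, b i * ((y i : ℝ) : ℂ) ^ 2 + ∑ i, (0 : ℂ) * (y i : ℂ)) := by
          refine integral_congr_ae (ae_of_all _ fun y => ?_)
          simp only [hg₀, hexp0 y]
      _ = ∏ i, ((π : ℂ) / b i) ^ (1 / 2 : ℂ) * cexp ((0 : ℂ) ^ 2 / (4 * b i)) :=
          GaussianFourier.integral_cexp_neg_sum_mul_add hbre _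
      _ = ∏ i, ((π : ℂ) / b i) ^ (1 / 2 : ℂ) := by simp
  -- change of variables `x = Ty`
  have habs : |T.det| ≠ 0 := abs_ne_zero.mpr hTdet
  have hback : ∀ f : (ι → ℝ) → ℂ, ∫ x, f x = ((|T.det| : ℝ) : ℂ) * ∫ y, f (T *ᵥ y) := fun f => by
    have hcv := integral_comp_mulVec_real T hTdet f
    have : ∫ x, f x = |T.det| • (|T.det|⁻¹ • ∫ x, f x) := by
      rw [smul_smul, mul_inv_cancel₀ habs, one_smul]
    rw [this, ← hcv, Complex.real_smul]
  have hI : ∫ x, g x = ((|T.det| : ℝ) : ℂ) * ∏ i, ((π : ℂ) / b i) ^ (1 / 2 : ℂ) * cexp (c i ^ 2 / (4 * b i)) := by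
    rw [hback g, hpull]
  have hI0 : ∫ x, g₀ x = ((|T.det| : ℝ) : ℂ) * ∏ i, ((π : ℂ) / b i) ^ (1 / 2 : ℂ) := by
    rw [hback g₀, hpull0]
  -- the inverse: `A⁻¹ = T·diag(2b)⁻¹·Tᵀ`, so `½JᵀA⁻¹J = Σ c_k²/(4b_k)`
  have hTcdet : Tc.det = ((T.det : ℝ) : ℂ) := by
    rw [hTc, hofReal, ← RingHom.mapMatrix_apply, ← RingHom.map_det]
  have hTcU : IsUnit Tc.det := by
    rw [hTcdet]
    exact (Ne.isUnit (by exact_mod_cast hTdet))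
  have hDU : IsUnit D.det := by
    rw [hD, det_diagonal]
    exact (Finset.prod_ne_zero_iff.mpr fun i _ => h2bne i).isUnit
  have hDinv' : diagonal (fun i => (2 * b i)⁻¹) * D = 1 := by
    rw [hD, diagonal_mul_diagonal, ← diagonal_one]
    congr 1
    funext i
    exact inv_mul_cancel₀ (h2bne i)
  have hDinv : D⁻¹ = diagonal (fun i => (2 * b i)⁻¹) := Matrix.inv_eq_left_inv hDinv'
  have hTA : Tcᵀ * A = D * Tc⁻¹ := by
    have h := congrArg (· * Tc⁻¹) hconj
    simpa only [Matrix.mul_assoc, Matrix.mul_nonsing_inv _ hTcU, Matrix.mul_one] using h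
  have hleft : (Tc * D⁻¹ * Tcᵀ) * A = 1 := by
    calc (Tc * D⁻¹ * Tcᵀ) * A = Tc * D⁻¹ * (Tcᵀ * A) := by simp only [Matrix.mul_assoc]
      _ = Tc * (D⁻¹ * D) * Tc⁻¹ := by rw [hTA]; simp only [Matrix.mul_assoc]
      _ = 1 := by rw [Matrix.nonsing_inv_mul _ hDU, Matrix.mul_one, Matrix.mul_nonsing_inv _ hTcU]
  have hAinv : A⁻¹ = Tc * D⁻¹ * Tcᵀ := Matrix.inv_eq_left_inv hleft
  have hquadInv : J ⬝ᵥ (A⁻¹ *ᵥ J) = ∑ i, c i ^ 2 / (2 * b i) := by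
    rw [hAinv, ← Matrix.mulVec_mulVec, ← Matrix.mulVec_mulVec, Matrix.dotProduct_mulVec,
      ← Matrix.mulVec_transpose, ← hc, hDinv]
    simp only [dotProduct, mulVec_diagonal]
    exact Finset.sum_congr rfl fun i _ => by rw [div_eq_mul_inv]; ring
  have hquadInv' : (1 / 2 : ℂ) * (J ⬝ᵥ (A⁻¹ *ᵥ J)) = ∑ i, c i ^ 2 / (4 * b i) := by
    rw [hquadInv, Finset.mul_sum]
    refine Finset.sum_congr rfl fun i _ => ?_
    field_simp
    ring
  -- assemble
  change ∫ x, g x = _ * ∫ x, g₀ x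
  rw [hI, hI0, hquadInv', Complex.exp_sum, Finset.prod_mul_distrib]
  ring

/-- **Zero-freeness of the normalisation** in this phrasing: `∫_{ℝⁿ} e^{-½xᵀAx} dx ≠ 0` for a complex
symmetric `A` with `Re A ≻ 0` (from `RealGaussianComplexQuadratic.integral_cexp_neg_half_add_quadratic_ne_zero`
with the purely imaginary tilt `M = −(i/2) Im A`). [cite: HormanderALPDO1, Thm 7.6.1] -/
theorem integral_cexp_neg_half_quadratic_ne_zero {A : Matrix ι ι ℂ} (hA : A.IsSymm)
    (hAre : (A.map Complex.re).PosDef) :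
    (∫ x : ι → ℝ, cexp (-(1 / 2 : ℂ) * ((fun i => (x i : ℂ)) ⬝ᵥ (A *ᵥ fun i => (x i : ℂ))))) ≠ 0 := by
  set M : Matrix ι ι ℂ := (-(I / 2)) • (A.map Complex.im).map Complex.ofReal with hM
  have hMs : M.IsSymm := by
    show ((-(I / 2)) • (A.map Complex.im).map Complex.ofReal)ᵀ = (-(I / 2)) • (A.map Complex.im).map Complex.ofReal
    rw [transpose_smul, ← Matrix.transpose_map, ← Matrix.transpose_map, hA.eq]
  have hMre : M.map Complex.re = 0 := by
    ext i j
    simp [hM, Matrix.map_apply]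
  have hAM : (A.map Complex.re - (2 : ℝ) • M.map Complex.re).PosDef := by
    rw [hMre, smul_zero, sub_zero]
    exact hAre
  have h := (integral_cexp_neg_half_add_quadratic_ne_zero hMs hAM).1
  have hint : ∀ x : ι → ℝ,
      -(1 / 2 : ℂ) * ((fun i => (x i : ℂ)) ⬝ᵥ (A *ᵥ fun i => (x i : ℂ))) =
        -(1 / 2 : ℂ) * ((x ⬝ᵥ (A.map Complex.re *ᵥ x) : ℝ) : ℂ) +
          (fun i => (x i : ℂ)) ⬝ᵥ (M *ᵥ fun i => (x i : ℂ)) := fun x => by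
    have hMx : (fun i => (x i : ℂ)) ⬝ᵥ (M *ᵥ fun i => (x i : ℂ))
        = (-(I / 2)) * (((x ⬝ᵥ (A.map Complex.im *ᵥ x) : ℝ) : ℂ)) := by
      rw [hM, smul_mulVec, dotProduct_smul, smul_eq_mul]
      congr 1
      simp only [dotProduct, mulVec, Matrix.map_apply, Complex.ofReal_sum, Complex.ofReal_mul]
    rw [hMx, dotProduct_mulVec_ofReal_eq]
    ring
  simp_rw [hint]
  exact h

/-- **The generating function of the complex Gaussian, normalised form**:
`∫ e^{-½xᵀAx + Jᵀx} / ∫ e^{-½xᵀAx} = e^{½JᵀA⁻¹J}` (`A` complex symmetric, `Re A ≻ 0`, `J ∈ ℂⁿ`).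
[cite: HormanderALPDO1, Thm 7.6.1] -/
theorem div_integral_cexp_neg_half_quadratic_add_linear {A : Matrix ι ι ℂ} (hA : A.IsSymm)
    (hAre : (A.map Complex.re).PosDef) (J : ι → ℂ) :
    (∫ x : ι → ℝ, cexp (-(1 / 2 : ℂ) * ((fun i => (x i : ℂ)) ⬝ᵥ (A *ᵥ fun i => (x i : ℂ))) +
        J ⬝ᵥ fun i => (x i : ℂ))) /
      (∫ x : ι → ℝ, cexp (-(1 / 2 : ℂ) * ((fun i => (x i : ℂ)) ⬝ᵥ (A *ᵥ fun i => (x i : ℂ))))) =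
        cexp ((1 / 2 : ℂ) * (J ⬝ᵥ (A⁻¹ *ᵥ J))) := by
  rw [integral_cexp_neg_half_quadratic_add_linear hA hAre J,
    mul_div_cancel_right₀ _ (integral_cexp_neg_half_quadratic_ne_zero hA hAre)]

/-- **The same with the sign met in cluster expansions**: `∫ e^{-½xᵀAx − xᵀJ} = e^{½JᵀA⁻¹J}·∫ e^{-½xᵀAx}`
(the quadratic form `JᵀA⁻¹J` is even in `J`; written with `x ⬝ᵥ J`). [cite: HormanderALPDO1, Thm 7.6.1] -/
theorem integral_cexp_neg_half_quadratic_sub_linear {A : Matrix ι ι ℂ} (hA : A.IsSymm)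
    (hAre : (A.map Complex.re).PosDef) (J : ι → ℂ) :
    ∫ x : ι → ℝ, cexp (-(1 / 2 : ℂ) * ((fun i => (x i : ℂ)) ⬝ᵥ (A *ᵥ fun i => (x i : ℂ))) -
        (fun i => (x i : ℂ)) ⬝ᵥ J) =
      cexp ((1 / 2 : ℂ) * (J ⬝ᵥ (A⁻¹ *ᵥ J))) *
        ∫ x : ι → ℝ, cexp (-(1 / 2 : ℂ) * ((fun i => (x i : ℂ)) ⬝ᵥ (A *ᵥ fun i => (x i : ℂ)))) := by
  have h := integral_cexp_neg_half_quadratic_add_linear hA hAre (-J)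
  have hev : (-J) ⬝ᵥ (A⁻¹ *ᵥ (-J)) = J ⬝ᵥ (A⁻¹ *ᵥ J) := by
    rw [Matrix.mulVec_neg, neg_dotProduct, dotProduct_neg, neg_neg]
  rw [hev] at h
  rw [← h]
  refine integral_congr_ae (ae_of_all _ fun x => ?_)
  simp only [neg_dotProduct, dotProduct_comm J, sub_eq_add_neg]

end Literature.Analysis.SpecialFunctions

end
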